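import Mathlib
import HarnessLib
import Literature.Combinatorics.Additive.SizeOfAtomsModP

/-!
# Hamidoune–Serra–Zémor 2006, Theorem 3 (the case `m = 1` of the critical pair conjecture in
# `ℤ/pℤ`): §5 (Lemmas 20, 21, 22) and §6 (the proof of Theorem 3)

Topic `Literature/Combinatorics/Additive`.  Cell `mm-stpp` (D-0046), seat `mm-stpp-lit` (gen 18);
census-silent Literature shelf.  Companion of `CompressionTransferModP.lean` (§3, Theorem 10 =
`CompressionTransfer.compression_transfer`), `SizeOfAtomsModP.lean` (§2 layers, §4 Theorem 14 =
`AtomLayers.card_eq_four_of_isAtom_four` / `card_eq_five_of_isAtom_five`) and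
`IsoperimetricMethod.lean` (atoms; Proposition 8 = `Isoperimetric.IsAtom.card_le_of_conn_le`).

## Source (read at the page this session)

Y. O. Hamidoune, O. Serra, G. Zémor, *On the critical pair theory in `ℤ/pℤ`*, Acta Arith. 121
(2006) 99–115 = arXiv:math/0507561 (`paper:arxiv-math_0507561`; §1 Theorem 3 = chunk p0003,
§5 = p0010, §6 = p0011).

## What is here (all PROVED; no `sorry`, no named facts)

* **THEOREM 3** (§1, p0003: «Let `A, B` be subsets of `ℤ/pℤ` such that `|A| ≥ 4` and `|B| ≥ 5`.
  If `p ≥ 53` and `|A + B| ≤ |A| + |B| + 1 ≤ p − 5`, then there is `r ∈ ℤ/pℤ` such that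
  `ℓ_r(A) ≤ |A| + 2` and `ℓ_r(B) ≤ |B| + 2`»): `HSZMain.two_above_critical_pair` — unconditional,
  `= main_of_lemma22 lemma22`; symmetric packaging `two_above_critical_pair_symm`
  (`|A|, |B| ≥ 4`, `max ≥ 5`).
* **§6, the proof of Theorem 3 from its ingredients**: `HSZMain.main_of_lemma22` — Theorem 3
  proved from the tree's Theorem 10 (`CompressionTransfer.compression_transfer`), Theorem 14
  (i)–(ii) and Proposition 8, with Lemma 22 as an explicit hypothesis binder `h22` (kept in this
  form: it records exactly what §6 consumes).  The §6 bookkeeping: atoms through `0` exist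
  (`exists_isAtom_zero_mem`), the admissible witness bounds `κ_k` (tree `Isoperimetric.conn_le`),
  the below-critical escape `exists_common_apFinset_of_card_add_le` (`|X + Y| ≤ |X| + |Y|` ⇒ common
  difference by Vosper / Hamidoune–Rødseth, so that Lemma 22 is only needed at `|A + U| = 10`
  exactly), the translation and the `A ↔ B` symmetry reductions (`case_four`, `case_five`).
* **§5, Lemma 20** (p0010: «Let `p > 23` and let `A, B ⊂ ℤ/pℤ` with `|A| = 4`, `|B| = 5` and
  `|A + B| = 10`.  Then `c_d(A) ≤ 2` for some `d`»): `HSZMain.exists_card_vadd_sdiff_le_two`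
  (`0 ∈ A`, `|A + B| ≤ 10`; conclusion `|(d + A) ∖ A| ≤ 2`, `d ≠ 0`), by Lemma 19
  (`AtomLayers.exists_unique_add_of_card_four`) and inclusion–exclusion over the four translates
  `c + A`, `c ∈ B ∖ b` (`card_vadd_inter_vadd`).
* **§5, Lemma 21** (p0010: «Let `p` be any odd prime and let `Z ⊂ ℤ/pℤ` with `0 ∈ Z` and
  `|Z| < (p+9)/4`.  If `c_d(Z) ≤ 2` for some `d` then some affine image of `Z` is a subset of
  `{0, 1, …, (p−1)/2}`»): `HSZMain.exists_subset_half_apFinset` (at most two `d`-runs,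
  `4|Z| ≤ p + 7` ⇒ `Z` inside an `e`-progression with `(p+1)/2` terms, `e ≠ 0`), over the printed
  computation `subset_half_apFinset_of_two_runs` (dilation by `2`).
* **§5, Lemma 22** («Let `p > 23` and let `A, B ⊂ ℤ/pℤ` with `0 ∈ A ∩ B`, `|A| = 4`, `|B| = 5` and
  `|A + B| = 10`.  Then there exists `r` with `ℓ_r(A) ≤ 6` and `ℓ_r(B) ≤ 7`»): `HSZMain.lemma22`
  (for `p ≥ 37`, `|A + B| ≤ 10`).  First case («`c_d(A+B) ≤ 2` for some `d` … `A + B` can be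
  considered as a sum in `ℤ` and Lemma 9 implies the result»): `lemma22_of_runs_le_two`, via
  Lemma 21, the tree's integer lift (`CompressionTransfer.lift`, `card_lift_add_lift`) and Lemma 9
  (`CompressionTransfer.subset_apFinset_pair_int`).  Second case («Assume now that `A + B` has at
  least three `x`-components for every `x`» — impossible): `false_of_two_runs`, from Lemma 20 and
  the printed `d`-component casework `false_of_three_one` (`|A₁| = 3`) / `false_of_two_two`
  (`A = {0,d} + {0,x}`), run through the run count `c_d(X) = |(d + X) ∖ X|`, its submodularity
  `runs_union_add_runs_inter_le` and the gluing principle `subset_or_subset_of_two_le_runs`; the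
  sub-case «`c_d(A) = 1`» is closed by Theorem 10 instead of «nothing to prove».

## Deviations from print

* The printed §6 applies Theorem 10 to `(X, Y) = (A, U)` with `U` a `4`-atom of `A`, which needs
  `|A + U| ≤ p − 5`; from `|A + B| ≤ p − 5`, `|B| ≥ 5`, `|U| ≤ 6` one only gets `|A + U| ≤ p − 4`.
  We first reduce, by the symmetry of the statement, to `|A| ≤ |B|` when both have at least five
  elements (then `|A| ≤ (p − 6)/2` and there is room); the case `|A| = 4` is as printed.
* Lemma 22 is stated for `p ≥ 37`: the printed appeal to Lemma 21 with `Z = A + B`,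
  `|Z| = 10` needs `10 < (p+9)/4`, i.e. `p > 31`, not only the lemma's `p > 23` (harmless for
  Theorem 3, where `p ≥ 53`).  Lemma 21 is stated through runs (`|(d + Z) ∖ Z| ≤ 2`) and a covering
  half-progression rather than an affine map; `0 ∈ Z` is not used.
* Where the paper invokes Lemma 22 for an atom pair `(X, U)` with `|X + U| = κ + |U| ≤ 10`, the
  sub-case `|X + U| ≤ 9` is dispatched by Vosper's / Hamidoune–Rødseth's theorem directly.
* In Lemma 22's second case the printed text bounds `|A + B|` through the `d`-components of the
  four sums `A_i + B_j`; we obtain the same contradictions from the submodularity of the run count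
  (the intersection `(A₁ + B) ∩ (A₂ + B)` is a single run of four points, which must sit inside one
  piece on each side), and where the print says «otherwise there is nothing to prove»
  (`c_d(A) = 1`, `c_d(B) = 1`) we use Theorem 10, resp. the two-run count, explicitly.
-/

namespace Literature.Combinatorics.Additive

open Finset
open scoped Pointwise

namespace HSZMain

variable {p : ℕ} [hp : Fact p.Prime]

/-- A `k`-separable set has a `k`-atom through `0` (translate any atom). [cite:
HamidouneSerraZemor2006, §2 («there is no loss of generality in considering equivalent sets»;
§6: «Let U be a 5-atom of A»)] -/
theorem exists_isAtom_zero_mem {k : ℕ} {X : Finset (ZMod p)} (hk : 1 ≤ k)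
    (hsep : Isoperimetric.IsSeparable k X) :
    ∃ U : Finset (ZMod p), Isoperimetric.IsAtom k X U ∧ (0 : ZMod p) ∈ U := by
  obtain ⟨U₀, hU₀⟩ := Isoperimetric.exists_isAtom hsep
  obtain ⟨u, hu⟩ : U₀.Nonempty := card_pos.1 (by have := hU₀.1.1.1; omega)
  exact ⟨(-u) +ᵥ U₀, hU₀.vadd (-u), mem_vadd_finset.2 ⟨u, hu, by simp⟩⟩

/-- **Below the critical count the inverse theorems give a common difference at once**: if
`|X|, |Y| ≥ 3`, `|X| + |Y| ≥ 7`, `|X + Y| ≤ |X| + |Y|` and `|X| + |Y| + 4 ≤ p`, then `X` and `Y` lie in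
progressions with `|X| + 1`, `|Y| + 1` terms and ONE difference `r ≠ 0` (Cauchy–Davenport, then
Vosper's theorem or the Hamidoune–Rødseth theorem). [cite: HamidouneSerraZemor2006, §1.1
(Theorem 1 of Vosper / Theorem 2 of Hamidoune–Rødseth as the cases m = −1, 0)] -/
theorem exists_common_apFinset_of_card_add_le {X Y : Finset (ZMod p)} (hX3 : 3 ≤ #X)
    (hY3 : 3 ≤ #Y) (h7 : 7 ≤ #X + #Y) (hXY : #(X + Y) ≤ #X + #Y) (hpXY : #X + #Y + 4 ≤ p) :
    ∃ r : ZMod p, r ≠ 0 ∧ ∃ a b : ZMod p,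
      X ⊆ apFinset a r (#X + 1) ∧ Y ⊆ apFinset b r (#Y + 1) := by
  have hne : X + Y ≠ univ := fun h => by
    rw [h, card_univ, ZMod.card] at hXY
    omega
  have hCD := Vosper.cauchy_davenport_of_ne_univ (card_pos.1 (by omega)) (card_pos.1 (by omega))
    hne
  obtain h | h : #(X + Y) = #X + #Y - 1 ∨ #(X + Y) = #X + #Y := by omega
  · obtain ⟨r, hr, ⟨a, ha⟩, ⟨b, hb⟩⟩ := vosper_inverse (by omega) (by omega) h (by omega)
    refine ⟨r, hr, a, b, fun x hx => ?_, fun y hy => ?_⟩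
    · exact Rectification.apFinset_subset_apFinset_of_le a r (Nat.le_succ _)
        (ha.subst (motive := fun W => x ∈ W) hx)
    · exact Rectification.apFinset_subset_apFinset_of_le b r (Nat.le_succ _)
        (hb.subst (motive := fun W => y ∈ W) hy)
  · obtain ⟨r, a, b, hr, ha, hb⟩ :=
      Isoperimetric.hamidouneRodseth_inverse_theorem hX3 hY3 (by omega) h (by omega)
    exact ⟨r, hr, a, b, ha, hb⟩

/-- Undoing a translation inside a progression. [cite: HamidouneSerraZemor2006, §2 («equivalent
sets»)] -/
theorem subset_apFinset_of_vadd_subset {A : Finset (ZMod p)} {c a r : ZMod p} {n : ℕ}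
    (h : c +ᵥ A ⊆ apFinset a r n) : A ⊆ apFinset (-c + a) r n := by
  intro x hx
  have := h (mem_vadd_finset.2 ⟨x, hx, rfl⟩)
  rw [← vadd_apFinset]
  exact mem_vadd_finset.2 ⟨c +ᵥ x, this, by rw [vadd_eq_add, vadd_eq_add, neg_add_cancel_left]⟩

/-- The step «`|X| = 4`, `U` a `5`-atom of `X` with `|U| = 5`, so `|X + U| ≤ 10`, hence (Lemma 22,
or Vosper / Hamidoune–Rødseth below `10`) `ℓ_r(X) ≤ 6` for some `r ≠ 0`».
[cite: HamidouneSerraZemor2006, §6 (proof of Theorem 3: «By Lemma 22 we have ℓ_r(A) ≤ |A| + 2»)] -/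
theorem exists_subset_apFinset_six
    (h22 : ∀ X U : Finset (ZMod p), (0 : ZMod p) ∈ X → (0 : ZMod p) ∈ U → #X = 4 → #U = 5 →
      #(X + U) = 10 → ∃ r : ZMod p, r ≠ 0 ∧ (∃ a, X ⊆ apFinset a r 6) ∧ ∃ b, U ⊆ apFinset b r 7) (hp14 : 14 ≤ p) {X U : Finset (ZMod p)}
    (h0X : (0 : ZMod p) ∈ X) (h0U : (0 : ZMod p) ∈ U) (hX : #X = 4) (hU : #U = 5)
    (hXU : #(X + U) ≤ 10) : ∃ r : ZMod p, r ≠ 0 ∧ ∃ a, X ⊆ apFinset a r 6 := by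
  by_cases h10 : #(X + U) = 10
  · obtain ⟨r, hr, hXr, -⟩ := h22 X U h0X h0U hX hU h10
    exact ⟨r, hr, hXr⟩
  · obtain ⟨r, hr, a, b, ha, -⟩ :=
      exists_common_apFinset_of_card_add_le (X := X) (Y := U) (by omega) (by omega) (by omega)
        (by omega) (by omega)
    exact ⟨r, hr, a, fun x hx =>
      Rectification.apFinset_subset_apFinset_of_le a r (by omega) (ha hx)⟩

/-- **§6, case `|A| = 4`** (with `0 ∈ A`): a `5`-atom `U ∋ 0` of `A` has `|U| = 5` (Theorem 14 (ii),
`κ_5(A) ≤ |B + A| − |B| ≤ |A| + 1` as `B` is `5`-admissible), `ℓ_r(A) ≤ 6` (Lemma 22), and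
Theorem 10 transfers the compression to `B`. [cite: HamidouneSerraZemor2006, §6 (proof of
Theorem 3, «Suppose that |A| = 4»)] -/
theorem case_four
    (h22 : ∀ X U : Finset (ZMod p), (0 : ZMod p) ∈ X → (0 : ZMod p) ∈ U → #X = 4 → #U = 5 →
      #(X + U) = 10 → ∃ r : ZMod p, r ≠ 0 ∧ (∃ a, X ⊆ apFinset a r 6) ∧ ∃ b, U ⊆ apFinset b r 7) (hp53 : 53 ≤ p) {A B : Finset (ZMod p)}
    (h0A : (0 : ZMod p) ∈ A) (hA : #A = 4) (hB5 : 5 ≤ #B) (hAB : #(A + B) ≤ #A + #B + 1)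
    (hABp : #A + #B + 6 ≤ p) :
    ∃ r : ZMod p, r ≠ 0 ∧ (∃ a, A ⊆ apFinset a r (#A + 2)) ∧ ∃ b, B ⊆ apFinset b r (#B + 2) := by
  classical
  have hBA : #(B + A) = #(A + B) := by rw [add_comm]
  have hadm : Isoperimetric.IsAdm 5 A B := ⟨hB5, by rw [ZMod.card]; omega⟩
  have hconn : Isoperimetric.conn 5 A ≤ #A + 1 := by
    have := Isoperimetric.conn_le hadm
    omega
  obtain ⟨U, hU, h0U⟩ := exists_isAtom_zero_mem (by norm_num) ⟨B, hadm⟩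
  have hU5 : #U = 5 := AtomLayers.card_eq_five_of_isAtom_five h0A hA hconn (by omega) hU
  have hUA : #(U + A) ≤ 10 := by
    have h1 := hU.1.2
    have h2 : #U ≤ #(U + A) := card_le_card_add_right ⟨0, h0A⟩
    omega
  obtain ⟨r, hr, a, hAr⟩ := exists_subset_apFinset_six h22 (by omega) h0A h0U hA hU5
    (by rw [add_comm]; exact hUA)
  obtain ⟨b, hBr⟩ := CompressionTransfer.compression_transfer (by omega) hr hB5 (by omega)
    (by omega : #(B + A) ≤ #B + #A + 1) (by omega) (by rw [hA]; exact hAr)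
  exact ⟨r, hr, ⟨a, by rw [hA]; exact hAr⟩, b, hBr⟩

/-- **§6, case `|A| ≥ 5`** (with `0 ∈ A` and, by symmetry, `|A| ≤ |B|`): a `4`-atom `U ∋ 0` of `A`
has `|U| ≤ 6` (Proposition 8); if `|U| = 4`, a `5`-atom `V ∋ 0` of `U` has `|V| = 5` and Lemma 22
gives `ℓ_r(U) ≤ 6`; if `|U| ∈ {5, 6}`, a `4`-atom `V ∋ 0` of `U` has `|V| = 4` (Theorem 14 (i)), a
`5`-atom `W ∋ 0` of `V` has `|W| = 5`, Lemma 22 gives `ℓ_r(V) ≤ 6` and Theorem 10 `ℓ_r(U) ≤ |U| + 2`;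
then Theorem 10 twice: `ℓ_r(A) ≤ |A| + 2`, `ℓ_r(B) ≤ |B| + 2`. [cite: HamidouneSerraZemor2006, §6
(proof of Theorem 3, «Suppose now that |A| ≥ 5»)] -/
theorem case_five
    (h22 : ∀ X U : Finset (ZMod p), (0 : ZMod p) ∈ X → (0 : ZMod p) ∈ U → #X = 4 → #U = 5 →
      #(X + U) = 10 → ∃ r : ZMod p, r ≠ 0 ∧ (∃ a, X ⊆ apFinset a r 6) ∧ ∃ b, U ⊆ apFinset b r 7) (hp53 : 53 ≤ p) {A B : Finset (ZMod p)}
    (h0A : (0 : ZMod p) ∈ A) (hA5 : 5 ≤ #A) (hB5 : 5 ≤ #B) (hAleB : #A ≤ #B)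
    (hAB : #(A + B) ≤ #A + #B + 1) (hABp : #A + #B + 6 ≤ p) :
    ∃ r : ZMod p, r ≠ 0 ∧ (∃ a, A ⊆ apFinset a r (#A + 2)) ∧ ∃ b, B ⊆ apFinset b r (#B + 2) := by
  classical
  have hBA : #(B + A) = #(A + B) := by rw [add_comm]
  have hA12 : #A + 12 ≤ p := by omega
  -- `κ_4(A) ≤ |A| + 1` through the witness `B`
  have hadm : Isoperimetric.IsAdm 4 A B := ⟨by omega, by rw [ZMod.card]; omega⟩
  have hconn : Isoperimetric.conn 4 A ≤ #A + 1 := by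
    have := Isoperimetric.conn_le hadm
    omega
  obtain ⟨U, hU, h0U⟩ := exists_isAtom_zero_mem (by norm_num) ⟨B, hadm⟩
  have hU4 : 4 ≤ #U := hU.1.1.1
  have hU6 : #U ≤ 6 :=
    Isoperimetric.IsAtom.card_le_of_conn_le h0A (by norm_num) (by omega) hconn (by omega) hU
  have hUA : #(U + A) ≤ #A + #U + 1 := by
    have h1 := hU.1.2
    have h2 : #U ≤ #(U + A) := card_le_card_add_right ⟨0, h0A⟩
    omega
  have hAU : #(A + U) = #(U + A) := by rw [add_comm]
  -- it suffices to compress `U` into `|U| + 2` terms of some `r ≠ 0`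
  suffices hUr : ∃ r : ZMod p, r ≠ 0 ∧ ∃ u, U ⊆ apFinset u r (#U + 2) by
    obtain ⟨r, hr, u, hUr⟩ := hUr
    obtain ⟨a, hAr⟩ := CompressionTransfer.compression_transfer (by omega) hr hA5 hU4
      (by omega : #(A + U) ≤ #A + #U + 1) (by omega) hUr
    obtain ⟨b, hBr⟩ := CompressionTransfer.compression_transfer (by omega) hr hB5 (by omega)
      (by omega : #(B + A) ≤ #B + #A + 1) (by omega) hAr
    exact ⟨r, hr, ⟨a, hAr⟩, b, hBr⟩
  rcases Nat.lt_or_ge #U 5 with hU4' | hU5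
  · -- `|U| = 4`: a `5`-atom `V ∋ 0` of `U`
    have hUeq : #U = 4 := by omega
    have hadmU : Isoperimetric.IsAdm 5 U A := ⟨hA5, by rw [ZMod.card]; omega⟩
    have hconnU : Isoperimetric.conn 5 U ≤ #U + 1 := by
      have := Isoperimetric.conn_le hadmU
      omega
    obtain ⟨V, hV, h0V⟩ := exists_isAtom_zero_mem (by norm_num) ⟨A, hadmU⟩
    have hV5 : #V = 5 := AtomLayers.card_eq_five_of_isAtom_five h0U hUeq hconnU (by omega) hV
    have hVU : #(V + U) ≤ 10 := by
      have h1 := hV.1.2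
      have h2 : #V ≤ #(V + U) := card_le_card_add_right ⟨0, h0U⟩
      omega
    obtain ⟨r, hr, u, hUr⟩ := exists_subset_apFinset_six h22 (by omega) h0U h0V hUeq hV5
      (by rw [add_comm]; exact hVU)
    exact ⟨r, hr, u, by rw [hUeq]; exact hUr⟩
  · -- `|U| ∈ {5, 6}`: a `4`-atom `V ∋ 0` of `U`, then a `5`-atom `W ∋ 0` of `V`
    have hadmU : Isoperimetric.IsAdm 4 U A := ⟨by omega, by rw [ZMod.card]; omega⟩
    have hconnU : Isoperimetric.conn 4 U ≤ #U + 1 := by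
      have := Isoperimetric.conn_le hadmU
      omega
    obtain ⟨V, hV, h0V⟩ := exists_isAtom_zero_mem (by norm_num) ⟨A, hadmU⟩
    have hV4 : #V = 4 := AtomLayers.card_eq_four_of_isAtom_four h0U hU4 hconnU (by omega) hV
    have hVU : #(V + U) ≤ #U + 5 := by
      have h1 := hV.1.2
      have h2 : #V ≤ #(V + U) := card_le_card_add_right ⟨0, h0U⟩
      omega
    have hadmV : Isoperimetric.IsAdm 5 V U := ⟨hU5, by rw [add_comm U V, ZMod.card]; omega⟩
    have hconnV : Isoperimetric.conn 5 V ≤ #V + 1 := by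
      have := Isoperimetric.conn_le hadmV
      rw [add_comm U V] at this
      omega
    obtain ⟨W, hW, h0W⟩ := exists_isAtom_zero_mem (by norm_num) ⟨U, hadmV⟩
    have hW5 : #W = 5 := AtomLayers.card_eq_five_of_isAtom_five h0V hV4 hconnV (by omega) hW
    have hWV : #(W + V) ≤ 10 := by
      have h1 := hW.1.2
      have h2 : #W ≤ #(W + V) := card_le_card_add_right ⟨0, h0V⟩
      omega
    obtain ⟨r, hr, v, hVr⟩ := exists_subset_apFinset_six h22 (by omega) h0V h0W hV4 hW5
      (by rw [add_comm]; exact hWV)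
    obtain ⟨u, hUr⟩ := CompressionTransfer.compression_transfer (by omega) hr hU5 (by omega)
      (by rw [add_comm U V]; omega : #(U + V) ≤ #U + #V + 1) (by rw [add_comm U V]; omega)
      (by rw [hV4]; exact hVr)
    exact ⟨r, hr, u, hUr⟩

/-- **Theorem 3 of Hamidoune–Serra–Zémor, from Lemma 22.**  «Let `A, B` be subsets of `ℤ/pℤ` with
`|A| ≥ 4` and `|B| ≥ 5`.  If `p ≥ 53` and `|A + B| ≤ |A| + |B| + 1 ≤ p − 5`, then there is
`r ∈ ℤ/pℤ` such that `ℓ_r(A) ≤ |A| + 2` and `ℓ_r(B) ≤ |B| + 2`.»  Here with the paper's Lemma 22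
as the hypothesis `h22` (§5 is not yet in the tree); §6 as printed otherwise: translate so that
`0 ∈ A` (resp. `0 ∈ B` after the symmetry `A ↔ B` when `|B| < |A|`), then `case_four` /
`case_five`. [cite: HamidouneSerraZemor2006, §1 Theorem 3 and §6 (its proof)] -/
theorem main_of_lemma22
    (h22 : ∀ X U : Finset (ZMod p), (0 : ZMod p) ∈ X → (0 : ZMod p) ∈ U → #X = 4 → #U = 5 →
      #(X + U) = 10 → ∃ r : ZMod p, r ≠ 0 ∧ (∃ a, X ⊆ apFinset a r 6) ∧ ∃ b, U ⊆ apFinset b r 7) (hp53 : 53 ≤ p) {A B : Finset (ZMod p)}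
    (hA4 : 4 ≤ #A) (hB5 : 5 ≤ #B) (hAB : #(A + B) ≤ #A + #B + 1) (hABp : #A + #B + 6 ≤ p) :
    ∃ r : ZMod p, r ≠ 0 ∧ (∃ a, A ⊆ apFinset a r (#A + 2)) ∧ ∃ b, B ⊆ apFinset b r (#B + 2) := by
  classical
  -- translating one of the sets changes nothing
  have key : ∀ A B : Finset (ZMod p), 4 ≤ #A → 5 ≤ #B → #(A + B) ≤ #A + #B + 1 →
      #A + #B + 6 ≤ p → (#A = 4 ∨ #A ≤ #B) →
      ∃ r : ZMod p, r ≠ 0 ∧ (∃ a, A ⊆ apFinset a r (#A + 2)) ∧ ∃ b, B ⊆ apFinset b r (#B + 2) := by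
    intro A B hA4 hB5 hAB hABp hcase
    obtain ⟨a₀, ha₀⟩ : A.Nonempty := card_pos.1 (by omega)
    have hcard : #((-a₀) +ᵥ A) = #A := card_vadd_finset _ _
    have hsum : #(((-a₀) +ᵥ A) + B) = #(A + B) := by
      rw [vadd_add_assoc, card_vadd_finset]
    have h0 : (0 : ZMod p) ∈ (-a₀) +ᵥ A := mem_vadd_finset.2 ⟨a₀, ha₀, by simp⟩
    have hres : ∃ r : ZMod p, r ≠ 0 ∧ (∃ a, ((-a₀) +ᵥ A) ⊆ apFinset a r (#((-a₀) +ᵥ A) + 2)) ∧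
        ∃ b, B ⊆ apFinset b r (#B + 2) := by
      by_cases h4 : #A = 4
      · exact case_four h22 hp53 h0 (by rw [hcard, h4]) hB5 (by rw [hsum, hcard]; exact hAB)
          (by rw [hcard]; exact hABp)
      · have hle : #A ≤ #B := hcase.resolve_left h4
        exact case_five h22 hp53 h0 (by rw [hcard]; omega) hB5 (by rw [hcard]; exact hle)
          (by rw [hsum, hcard]; exact hAB) (by rw [hcard]; exact hABp)
    obtain ⟨r, hr, ⟨a, hAr⟩, hBr⟩ := hres
    rw [hcard] at hAr
    exact ⟨r, hr, ⟨_, subset_apFinset_of_vadd_subset hAr⟩, hBr⟩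
  by_cases hA : #A = 4
  · exact key A B hA4 hB5 hAB hABp (Or.inl hA)
  by_cases hle : #A ≤ #B
  · exact key A B hA4 hB5 hAB hABp (Or.inr hle)
  · -- symmetry: `|B| < |A|`, both at least `5`
    obtain ⟨r, hr, hBr, hAr⟩ := key B A (by omega) (by omega) (by rw [add_comm]; omega)
      (by omega) (Or.inr (by omega))
    exact ⟨r, hr, hAr, hBr⟩

/-! ## §5, Lemma 20: a `(4,5)`-pair two above critical has a direction with at most two runs -/

section LemmaTwenty

variable {p : ℕ} [hp : Fact p.Prime]

/-- Two translates of `A` meet in `|A ∩ (d + A)|` points, `d` the difference of the translation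
vectors. [cite: HamidouneSerraZemor2006, §5 (proof of Lemma 20: «|(A+c) ∩ (A+c')| ≥ 2 or,
equivalently, |A + {0, c − c'}| ≤ |A| + 2»)] -/
theorem card_vadd_inter_vadd (A : Finset (ZMod p)) (c c' : ZMod p) :
    #((c +ᵥ A) ∩ (c' +ᵥ A)) = #(((c - c') +ᵥ A) ∩ A) := by
  classical
  have : (c +ᵥ A) ∩ (c' +ᵥ A) = c' +ᵥ (((c - c') +ᵥ A) ∩ A) := by
    ext z
    simp only [mem_inter, mem_vadd_finset, vadd_eq_add]
    constructor
    · rintro ⟨⟨a, ha, rfl⟩, ⟨a', ha', he⟩⟩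
      refine ⟨a', ⟨⟨a, ha, ?_⟩, ha'⟩, he⟩
      linear_combination -he
    · rintro ⟨w, ⟨⟨a, ha, rfl⟩, hw⟩, rfl⟩
      exact ⟨⟨a, ha, by abel⟩, ⟨_, hw, rfl⟩⟩
  rw [this, card_vadd_finset]

/-- **Lemma 20.** «Let `p > 23` and let `A, B ⊂ ℤ/pℤ` with `|A| = 4`, `|B| = 5` and `|A + B| = 10`.
Then `c_d(A) ≤ 2` for some `d ∈ ℤ/pℤ`» — here: `0 ∈ A` (a translation), `|A + B| ≤ 10`, and the
conclusion as `|(d + A) ∖ A| ≤ 2` for some `d ≠ 0` (at most two `d`-runs).  Proof as printed: by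
Lemma 19 some `z = x + b` is uniquely expressible, so `C = B ∖ {b}` has `|A + C| ≤ 9`; since
`A + C = ⋃_{c ∈ C} (c + A)` with four translates of size `4`, inclusion–exclusion forces two of them
to meet in `≥ 2` points, i.e. `|A ∩ (d + A)| ≥ 2` for `d = c − c'`.
[cite: HamidouneSerraZemor2006, §5, Lemma 20] -/
theorem exists_card_vadd_sdiff_le_two {A B : Finset (ZMod p)} (h0A : (0 : ZMod p) ∈ A)
    (hA : #A = 4) (hB : #B = 5) (hAB : #(A + B) ≤ 10) (hp23 : 23 < p) :
    ∃ d : ZMod p, d ≠ 0 ∧ #((d +ᵥ A) \ A) ≤ 2 := by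
  classical
  have hp29 : 29 ≤ p := by
    by_contra h
    have hpp := hp.out
    interval_cases p <;> norm_num at hpp
  -- Lemma 19: a uniquely expressible sum `b + x`
  obtain ⟨b, hb, x, hx, huniq⟩ :=
    AtomLayers.exists_unique_add_of_card_four (B := B) h0A hA (by omega) (by omega) (by omega)
  -- `C = B ∖ b`: `|A + C| ≤ 9`
  have hAC : #(A + B.erase b) ≤ 9 := by
    have hsub : A + B.erase b ⊆ (A + B).erase (x + b) := by
      intro z hz
      obtain ⟨x', hx', b', hb', rfl⟩ := mem_add.1 hz
      rw [mem_erase] at hb' ⊢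
      refine ⟨fun he => hb'.1 (huniq b' hb'.2 x' hx' ?_), add_mem_add hx' hb'.2⟩
      rw [add_comm b' x', he, add_comm]
    have := card_le_card hsub
    rw [card_erase_of_mem (add_mem_add hx hb)] at this
    omega
  -- the four translates `c + A`, `c ∈ C`
  have hC4 : #(B.erase b) = 4 := by rw [card_erase_of_mem hb, hB]
  obtain ⟨c₁, hc₁⟩ : (B.erase b).Nonempty := card_pos.1 (by omega)
  have hC3 : #((B.erase b).erase c₁) = 3 := by rw [card_erase_of_mem hc₁, hC4]
  obtain ⟨c₂, c₃, c₄, h23, h24, h34, hCeq⟩ := card_eq_three.1 hC3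
  have hc₂ : c₂ ∈ (B.erase b).erase c₁ := by rw [hCeq]; simp
  have hc₃ : c₃ ∈ (B.erase b).erase c₁ := by rw [hCeq]; simp
  have hc₄ : c₄ ∈ (B.erase b).erase c₁ := by rw [hCeq]; simp
  have h12 : c₁ ≠ c₂ := fun h => (mem_erase.1 hc₂).1 h.symm
  have h13 : c₁ ≠ c₃ := fun h => (mem_erase.1 hc₃).1 h.symm
  have h14 : c₁ ≠ c₄ := fun h => (mem_erase.1 hc₄).1 h.symm
  -- each translate lies in `A + C` and has four points
  have hS : ∀ c ∈ B.erase b, c +ᵥ A ⊆ A + B.erase b := fun c hc z hz => by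
    obtain ⟨a, ha, rfl⟩ := mem_vadd_finset.1 hz
    exact mem_add.2 ⟨a, ha, c, hc, by rw [vadd_eq_add, add_comm]⟩
  have hcardS : ∀ c : ZMod p, #(c +ᵥ A) = 4 := fun c => by rw [card_vadd_finset, hA]
  -- if all six pairwise intersections had at most one point, the union would have ≥ 10 points
  by_contra hnone
  push Not at hnone
  have hint : ∀ c c' : ZMod p, c ≠ c' → #((c +ᵥ A) ∩ (c' +ᵥ A)) ≤ 1 := by
    intro c c' hcc'
    by_contra hlt
    have h2 : 2 ≤ #(((c - c') +ᵥ A) ∩ A) := by rw [← card_vadd_inter_vadd]; omega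
    have hd : c - c' ≠ 0 := sub_ne_zero.2 hcc'
    have := hnone (c - c') hd
    have hsplit := card_sdiff_add_card_inter (((c - c') +ᵥ A)) A
    rw [hcardS] at hsplit
    omega
  have hU2 : 7 ≤ #((c₁ +ᵥ A) ∪ (c₂ +ᵥ A)) := by
    have := card_union_add_card_inter (c₁ +ᵥ A) (c₂ +ᵥ A)
    rw [hcardS, hcardS] at this
    have := hint c₁ c₂ h12
    omega
  have hU3 : 9 ≤ #((c₁ +ᵥ A) ∪ (c₂ +ᵥ A) ∪ (c₃ +ᵥ A)) := by
    have h1 := card_union_add_card_inter ((c₁ +ᵥ A) ∪ (c₂ +ᵥ A)) (c₃ +ᵥ A)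
    rw [hcardS, union_inter_distrib_right] at h1
    have h2 := card_union_le ((c₁ +ᵥ A) ∩ (c₃ +ᵥ A)) ((c₂ +ᵥ A) ∩ (c₃ +ᵥ A))
    have := hint c₁ c₃ h13
    have := hint c₂ c₃ h23
    omega
  have hU4 : 10 ≤ #((c₁ +ᵥ A) ∪ (c₂ +ᵥ A) ∪ (c₃ +ᵥ A) ∪ (c₄ +ᵥ A)) := by
    have h1 := card_union_add_card_inter ((c₁ +ᵥ A) ∪ (c₂ +ᵥ A) ∪ (c₃ +ᵥ A)) (c₄ +ᵥ A)
    rw [hcardS, union_inter_distrib_right, union_inter_distrib_right] at h1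
    have h2 := card_union_le ((c₁ +ᵥ A) ∩ (c₄ +ᵥ A) ∪ (c₂ +ᵥ A) ∩ (c₄ +ᵥ A))
      ((c₃ +ᵥ A) ∩ (c₄ +ᵥ A))
    have h3 := card_union_le ((c₁ +ᵥ A) ∩ (c₄ +ᵥ A)) ((c₂ +ᵥ A) ∩ (c₄ +ᵥ A))
    have := hint c₁ c₄ h14
    have := hint c₂ c₄ h24
    have := hint c₃ c₄ h34
    omega
  have hsub : (c₁ +ᵥ A) ∪ (c₂ +ᵥ A) ∪ (c₃ +ᵥ A) ∪ (c₄ +ᵥ A) ⊆ A + B.erase b := by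
    intro z hz
    simp only [mem_union] at hz
    rcases hz with ((hz | hz) | hz) | hz
    · exact hS c₁ hc₁ hz
    · exact hS c₂ (mem_of_mem_erase hc₂) hz
    · exact hS c₃ (mem_of_mem_erase hc₃) hz
    · exact hS c₄ (mem_of_mem_erase hc₄) hz
  have := card_le_card hsub
  omega

end LemmaTwenty

/-! ## §5, Lemma 21: a set with at most two runs and fewer than `(p+9)/4` points has an affine image
in a half-line -/

section LemmaTwentyOne

variable {p : ℕ} [hp : Fact p.Prime]

/-- Every element of `ℤ/pℤ` is `c + i d` with `i < p` (`d ≠ 0`). [folklore] -/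
private theorem exists_eq_add_nsmul' {d : ZMod p} (hd : d ≠ 0) (c x : ZMod p) :
    ∃ i : ℕ, i < p ∧ x = c + i • d := by
  refine ⟨((x - c) * d⁻¹).val, ZMod.val_lt _, ?_⟩
  rw [nsmul_eq_mul, ZMod.natCast_zmod_val, mul_assoc, inv_mul_cancel₀ hd, mul_one, add_sub_cancel]

/-- **Lemma 21, the computation.**  Two `d`-runs `{s, …, s + (a−1)d}` and
`{s + (a+v)d, …, s + (a+v+b−1)d}` with `b ≤ a`, the gap `v` after the first run at most the other
gap `w` (`a + v + b + w = p`), and `4(a + b) ≤ p + 7`: either everything lies in the half-run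
`{s, …, s + ((p−1)/2) d}`, or — «we must have `v + a + b − 1 ≥ (p+1)/2`. Moreover `2v + a + b ≤ p` …
`2*B` is represented by a subset of `{−2b+3, …, a+b−2}` … `2*A` by a subset of `{0, 2, …, 2a−2}`» —
the doubles lie in a `d`-run of at most `2(a+b) − 4 ≤ (p−1)/2` terms, so the set itself lies in a
half-run of step `d/2`. [cite: HamidouneSerraZemor2006, §5, Lemma 21 (proof)] -/
theorem subset_half_apFinset_of_two_runs {Z : Finset (ZMod p)} {s d : ZMod p} (hd : d ≠ 0)
    {a b v w : ℕ} (hZ : Z ⊆ apFinset s d a ∪ apFinset (s + (a + v) • d) d b) (hba : b ≤ a)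
    (hb : 1 ≤ b) (hvw : v ≤ w) (hsum : a + v + b + w = p) (h4 : 4 * (a + b) ≤ p + 7)
    (hp3 : 3 ≤ p) : ∃ c e : ZMod p, e ≠ 0 ∧ Z ⊆ apFinset c e ((p + 1) / 2) := by
  have hodd : p % 2 = 1 := Nat.odd_iff.1 (hp.out.odd_of_ne_two (by omega))
  have h2ne : (2 : ZMod p) ≠ 0 := by
    intro h
    have h' : ((2 : ℕ) : ZMod p) = 0 := by exact_mod_cast h
    rw [ZMod.natCast_eq_zero_iff] at h'
    have := Nat.le_of_dvd (by norm_num) h'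
    omega
  by_cases hcase : a + v + b ≤ (p + 1) / 2
  · refine ⟨s, d, hd, fun z hz => ?_⟩
    rcases mem_union.1 (hZ hz) with h | h
    · obtain ⟨x, hx, rfl⟩ := mem_apFinset.1 h
      exact mem_apFinset.2 ⟨x, by omega, rfl⟩
    · obtain ⟨j, hj, rfl⟩ := mem_apFinset.1 h
      exact mem_apFinset.2 ⟨a + v + j, by omega, by rw [add_nsmul, add_assoc]⟩
  · -- dilate by `2`
    obtain ⟨t, ht⟩ : ∃ t : ℕ, t = 2 * b - 3 := ⟨_, rfl⟩
    obtain ⟨c, hc⟩ : ∃ c : ZMod p, c = 2 * s - t • d := ⟨_, rfl⟩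
    have key : ∀ z ∈ Z, ∃ i : ℕ, i < (p + 1) / 2 ∧ 2 * z = c + i • d := by
      intro z hz
      rcases mem_union.1 (hZ hz) with h | h
      · obtain ⟨x, hx, rfl⟩ := mem_apFinset.1 h
        refine ⟨2 * x + t, by omega, ?_⟩
        rw [hc]
        simp only [nsmul_eq_mul]
        push_cast
        ring
      · obtain ⟨j, hj, rfl⟩ := mem_apFinset.1 h
        have hge : p ≤ 2 * (a + v + j) + t := by omega
        refine ⟨2 * (a + v + j) + t - p, by omega, ?_⟩
        have hcast : ((2 * (a + v + j) + t - p : ℕ) : ZMod p) = 2 * (a + v + j) + t := by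
          have e : 2 * (a + v + j) + t - p + p = 2 * (a + v + j) + t := by omega
          have := congrArg (Nat.cast : ℕ → ZMod p) e
          push_cast at this
          rw [ZMod.natCast_self, add_zero] at this
          exact this
        rw [hc]
        simp only [nsmul_eq_mul]
        rw [hcast]
        push_cast
        ring
    refine ⟨(2 : ZMod p)⁻¹ * c, (2 : ZMod p)⁻¹ * d, mul_ne_zero (inv_ne_zero h2ne) hd,
      fun z hz => ?_⟩
    obtain ⟨i, hi, h2z⟩ := key z hz
    refine mem_apFinset.2 ⟨i, hi, ?_⟩
    have h21 : (2 : ZMod p)⁻¹ * 2 = 1 := inv_mul_cancel₀ h2ne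
    calc (2 : ZMod p)⁻¹ * c + i • ((2 : ZMod p)⁻¹ * d) = (2 : ZMod p)⁻¹ * (c + i • d) := by
          simp only [nsmul_eq_mul]; ring
      _ = (2 : ZMod p)⁻¹ * (2 * z) := by rw [h2z]
      _ = z := by rw [← mul_assoc, h21, one_mul]

/-- **Lemma 21** («Let `p` be any odd prime and let `Z ⊂ ℤ/pℤ` with `0 ∈ Z` and `|Z| < (p+9)/4`.
If `c_d(Z) ≤ 2` for some `d ∈ (ℤ/pℤ)*` then some affine image of `Z` is a subset of
`{0, 1, …, (p−1)/2}`»), in the form: `Z ≠ ∅` with at most two `d`-runs (`|(d + Z) ∖ Z| ≤ 2`,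
`d ≠ 0`) and `4|Z| ≤ p + 7` lies in a progression `{c, c + e, …}` with `(p+1)/2` terms, `e ≠ 0`
(so that `x ↦ e⁻¹(x − c)` maps `Z` into `{0, …, (p−1)/2}`; `0 ∈ Z` is not needed).  Proof as
printed, the four orientations (which run is the longer, which gap follows it) reduced to the
computation `subset_half_apFinset_of_two_runs` by relabelling and `d ↦ −d`.
[cite: HamidouneSerraZemor2006, §5, Lemma 21] -/
theorem exists_subset_half_apFinset {Z : Finset (ZMod p)} {d : ZMod p} (hd : d ≠ 0)
    (hruns : #((d +ᵥ Z) \ Z) ≤ 2) (h4 : 4 * #Z ≤ p + 7) (hp7 : 7 ≤ p) :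
    ∃ c e : ZMod p, e ≠ 0 ∧ Z ⊆ apFinset c e ((p + 1) / 2) := by
  classical
  have hZu : Z ≠ univ := fun h => by
    rw [h, card_univ, ZMod.card] at h4
    omega
  rcases Nat.lt_or_ge #((d +ᵥ Z) \ Z) 2 with h1 | h2
  · obtain ⟨s, hs, -⟩ :=
      Isoperimetric.exists_eq_apFinset_of_card_vadd_sdiff_le_one hd hZu (by omega)
    exact ⟨s, d, hd, fun z hz => Rectification.apFinset_subset_apFinset_of_le s d (by omega)
      (hs.subst (motive := fun W => z ∈ W) hz)⟩
  · have h2' : #((d +ᵥ Z) \ Z) = 2 := by omega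
    obtain ⟨a₁, a₂, n₁, n₂, hn₁, hn₂, hn, hZeq, hdisj, hR₁, -, hpost₁, hR₂, -, hpost₂⟩ :=
      HamidouneRodseth.exists_two_components hd h2'
    have hnp : n₁ + n₂ < p := by omega
    obtain ⟨i, hip, ha₂⟩ := exists_eq_add_nsmul' hd a₁ a₂
    have hmem₁ : a₁ ∈ apFinset a₁ d n₁ := mem_apFinset.2 ⟨0, by omega, by rw [zero_nsmul, add_zero]⟩
    have hmem₂ : a₂ ∈ apFinset a₂ d n₂ := mem_apFinset.2 ⟨0, by omega, by rw [zero_nsmul, add_zero]⟩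
    -- the gap after the first run is positive
    have hi₁ : n₁ + 1 ≤ i := by
      by_contra hlt
      rcases Nat.lt_or_ge i n₁ with h | h
      · exact disjoint_left.1 hdisj (mem_apFinset.2 ⟨i, h, ha₂.symm⟩) hmem₂
      · have hin : i = n₁ := by omega
        have : a₂ ∈ Z := hR₂ hmem₂
        rw [ha₂, hin] at this
        exact hpost₁ this
    -- the second run ends before coming back to the first
    have hi₂ : i + n₂ + 1 ≤ p := by
      by_contra hlt
      rcases Nat.lt_or_ge p (i + n₂) with h | h
      · refine disjoint_left.1 hdisj hmem₁ (mem_apFinset.2 ⟨p - i, by omega, ?_⟩)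
        rw [ha₂, add_assoc, ← add_nsmul, show i + (p - i) = p by omega,
          HamidouneRodseth.prime_nsmul_eq_zero, add_zero]
      · have hpi : i + n₂ = p := by omega
        apply hpost₂
        have e : a₂ + n₂ • d = a₁ := by
          rw [ha₂, add_assoc, ← add_nsmul, hpi, HamidouneRodseth.prime_nsmul_eq_zero, add_zero]
        rw [e]
        exact hR₁ hmem₁
    -- the two gaps
    obtain ⟨v, hv⟩ : ∃ v : ℕ, i = n₁ + v := ⟨i - n₁, by omega⟩
    obtain ⟨w, hw⟩ : ∃ w : ℕ, p = i + n₂ + w := ⟨p - i - n₂, by omega⟩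
    have hsum₁ : n₁ + v + n₂ + w = p := by omega
    have h4' : 4 * (n₁ + n₂) ≤ p + 7 := by rw [hn]; exact h4
    have hZsub : Z ⊆ apFinset a₁ d n₁ ∪ apFinset a₂ d n₂ := Finset.subset_of_eq hZeq
    have ha₂' : a₂ = a₁ + (n₁ + v) • d := by rw [ha₂, hv]
    have ha₁' : a₁ = a₂ + (n₂ + w) • d := by
      rw [ha₂, add_assoc, ← add_nsmul, show i + (n₂ + w) = p by omega,
        HamidouneRodseth.prime_nsmul_eq_zero, add_zero]
    obtain ⟨m₁, rfl⟩ : ∃ m, n₁ = m + 1 := ⟨n₁ - 1, by omega⟩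
    obtain ⟨m₂, rfl⟩ : ∃ m, n₂ = m + 1 := ⟨n₂ - 1, by omega⟩
    -- the reversed runs
    have hR1 : apFinset a₁ d (m₁ + 1) = apFinset (a₁ + m₁ • d) (-d) (m₁ + 1) := by
      rw [Isoperimetric.apFinset_eq_apFinset_neg a₁ d (by omega : 1 ≤ m₁ + 1), Nat.add_sub_cancel]
    have hR2 : apFinset a₂ d (m₂ + 1) = apFinset (a₂ + m₂ • d) (-d) (m₂ + 1) := by
      rw [Isoperimetric.apFinset_eq_apFinset_neg a₂ d (by omega : 1 ≤ m₂ + 1), Nat.add_sub_cancel]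
    rcases le_total (m₂ + 1) (m₁ + 1) with hle | hle
    · rcases le_total v w with hvw | hwv
      · -- run 1, forward
        rw [ha₂'] at hZsub
        exact subset_half_apFinset_of_two_runs hd hZsub hle (by omega) hvw hsum₁ h4' (by omega)
      · -- run 1, backward: the gap after it is `w`
        have hbase : a₂ + m₂ • d = a₁ + m₁ • d + (m₁ + 1 + w) • (-d) := by
          rw [ha₁']
          simp only [nsmul_eq_mul]
          push_cast
          ring
        rw [hR1, hR2, hbase] at hZsub
        exact subset_half_apFinset_of_two_runs (neg_ne_zero.2 hd) hZsub hle (by omega) hwv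
          (by omega) h4' (by omega)
    · rcases le_total w v with hwv | hvw
      · -- run 2, forward: the gap after it is `w`
        rw [union_comm, ha₁'] at hZsub
        exact subset_half_apFinset_of_two_runs hd hZsub hle (by omega) hwv (by omega)
          (by omega) (by omega)
      · -- run 2, backward: the gap after it is `v`
        have hbase : a₁ + m₁ • d = a₂ + m₂ • d + (m₂ + 1 + v) • (-d) := by
          rw [ha₂']
          simp only [nsmul_eq_mul]
          push_cast
          ring
        rw [union_comm, hR1, hR2, hbase] at hZsub
        exact subset_half_apFinset_of_two_runs (neg_ne_zero.2 hd) hZsub hle (by omega) hvw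
          (by omega) (by omega) (by omega)

end LemmaTwentyOne

/-! ## §5, Lemma 22 — first case: `A + B` has at most two runs in some direction -/

section LemmaTwentyTwoCaseOne

variable {p : ℕ} [hp : Fact p.Prime]

/-- Mapping a progression of integers into `ℤ/pℤ` along `i ↦ c + i e`.
[cite: HamidouneSerraZemor2006, §3 (proof of Lemma 11: the sum «considered as a sum in ℤ»)] -/
theorem mem_apFinset_of_int {c e : ZMod p} {α δ i : ℤ} {n : ℕ} (hi : i ∈ apFinset α δ n) :
    c + (i : ZMod p) * e ∈ apFinset (c + (α : ZMod p) * e) ((δ : ZMod p) * e) n := by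
  obtain ⟨k, hk, rfl⟩ := mem_apFinset.1 hi
  refine mem_apFinset.2 ⟨k, hk, ?_⟩
  simp only [nsmul_eq_mul]
  push_cast
  ring

/-- **Lemma 22, first case** («Assume first that `c_d(A+B) ≤ 2` for some `d`.  Then by Lemma 21,
`Z = A + B` is such that `ℓ_a(Z) ≤ (p−1)/2` for some `a` … Since `0 ∈ A ∩ B` we have `A ∪ B ⊂ Z`
therefore `A + B` can be considered as a sum in `ℤ` and Lemma 9 implies the result»): `0 ∈ A ∩ B`,
`|A| = 4`, `|B| = 5`, `|A + B| ≤ 10`, `A + B` with at most two `d`-runs (`d ≠ 0`), `p ≥ 37`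
(for Lemma 21's `|Z| < (p+9)/4` with `|Z| = 10`; the printed `p > 23` does not suffice here) ⇒
some `r ≠ 0` has `A` in an `r`-progression with `6` terms and `B` in one with `7` terms.  The
transfer to `ℤ` is the tree's `CompressionTransfer.lift` (both sets inside one half-run, so
`M + L = p + 1`), Lemma 9 is `CompressionTransfer.subset_apFinset_pair_int`.
[cite: HamidouneSerraZemor2006, §5, Lemma 22 (proof, first case)] -/
theorem lemma22_of_runs_le_two {A B : Finset (ZMod p)} (h0A : (0 : ZMod p) ∈ A)
    (h0B : (0 : ZMod p) ∈ B) (hA : #A = 4) (hB : #B = 5) (hAB : #(A + B) ≤ 10) {d : ZMod p}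
    (hd : d ≠ 0) (hruns : #((d +ᵥ (A + B)) \ (A + B)) ≤ 2) (hp37 : 37 ≤ p) :
    ∃ r : ZMod p, r ≠ 0 ∧ (∃ a, A ⊆ apFinset a r 6) ∧ ∃ b, B ⊆ apFinset b r 7 := by
  classical
  have hodd : p % 2 = 1 := Nat.odd_iff.1 (hp.out.odd_of_ne_two (by omega))
  -- Lemma 21: `A + B`, hence `A` and `B`, inside a half-run `{c, c + e, …}` of `(p+1)/2` terms
  obtain ⟨c, e, he, hZ⟩ := exists_subset_half_apFinset hd hruns (by omega) (by omega)
  have hAZ : A ⊆ apFinset c e ((p + 1) / 2) := fun a ha => hZ (by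
    simpa using add_mem_add ha h0B)
  have hBZ : B ⊆ apFinset c e ((p + 1) / 2) := fun b hb => hZ (by
    simpa using add_mem_add h0A hb)
  -- the integer lifts
  have hhp : (p + 1) / 2 ≤ p := by omega
  have hcardA := CompressionTransfer.card_lift he hhp hAZ
  have hcardB := CompressionTransfer.card_lift he hhp hBZ
  have hcardAB := CompressionTransfer.card_lift_add_lift he (by omega) hAZ hBZ
  -- Lemma 9 in `ℤ`
  obtain ⟨δ, hδ, α, β, hA', hB'⟩ := CompressionTransfer.subset_apFinset_pair_int
    (A := CompressionTransfer.lift A c e ((p + 1) / 2))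
    (B := CompressionTransfer.lift B c e ((p + 1) / 2))
    (by omega) (by omega) (by rw [hcardA, hcardB, hA, hB]; norm_num) (by omega)
  rw [hcardA, hA] at hA'
  rw [hcardB, hB] at hB'
  -- `δ < (p+1)/2 < p`, so `δ e ≠ 0` in `ℤ/pℤ`
  have hδp : δ < p := by
    obtain ⟨i₁, hi₁, i₂, hi₂, hne⟩ := one_lt_card.1 (by omega : 1 < #(CompressionTransfer.lift A c e ((p + 1) / 2)))
    have hI₁ := (CompressionTransfer.mem_lift.1 hi₁).1
    have hI₂ := (CompressionTransfer.mem_lift.1 hi₂).1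
    obtain ⟨k₁, hk₁, hk₁i⟩ := mem_apFinset.1 (hA' hi₁)
    obtain ⟨k₂, hk₂, hk₂i⟩ := mem_apFinset.1 (hA' hi₂)
    rw [nsmul_eq_mul] at hk₁i hk₂i
    have hk : k₁ ≠ k₂ := fun h => hne (by rw [← hk₁i, ← hk₂i, h])
    rcases lt_or_gt_of_ne hk with h | h
    · have h1 : (1 : ℤ) ≤ (k₂ : ℤ) - k₁ := by omega
      have : δ ≤ ((k₂ : ℤ) - k₁) * δ := le_mul_of_one_le_left hδ.le h1
      have e : i₂ - i₁ = ((k₂ : ℤ) - k₁) * δ := by rw [← hk₁i, ← hk₂i]; ring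
      omega
    · have h1 : (1 : ℤ) ≤ (k₁ : ℤ) - k₂ := by omega
      have : δ ≤ ((k₁ : ℤ) - k₂) * δ := le_mul_of_one_le_left hδ.le h1
      have e : i₁ - i₂ = ((k₁ : ℤ) - k₂) * δ := by rw [← hk₁i, ← hk₂i]; ring
      omega
  have hr : ((δ : ℤ) : ZMod p) * e ≠ 0 := by
    refine mul_ne_zero (fun h => ?_) he
    rw [ZMod.intCast_zmod_eq_zero_iff_dvd] at h
    have := Int.le_of_dvd hδ h
    omega
  refine ⟨(δ : ZMod p) * e, hr, ⟨c + (α : ZMod p) * e, fun x hx => ?_⟩,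
    ⟨c + (β : ZMod p) * e, fun x hx => ?_⟩⟩
  · obtain ⟨i, hi, rfl⟩ := CompressionTransfer.exists_mem_lift hAZ hx
    exact mem_apFinset_of_int (hA' hi)
  · obtain ⟨i, hi, rfl⟩ := CompressionTransfer.exists_mem_lift hBZ hx
    exact mem_apFinset_of_int (hB' hi)

end LemmaTwentyTwoCaseOne

/-! ## §5, Lemma 22 — second case: `A + B` cannot have three runs in every direction

The printed `d`-component casework, recast through the run count `c_d(X) = |(d + X) ∖ X|` and its
submodularity. -/

section RunCalculus

variable {p : ℕ} [hp : Fact p.Prime]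

/-- `z ∈ d + X ↔ z − d ∈ X`. [folklore] -/
private theorem mem_vadd_iff' {X : Finset (ZMod p)} {d z : ZMod p} : z ∈ d +ᵥ X ↔ z - d ∈ X := by
  constructor
  · intro h
    obtain ⟨y, hy, rfl⟩ := mem_vadd_finset.1 h
    simpa [vadd_eq_add] using hy
  · intro h
    exact mem_vadd_finset.2 ⟨z - d, h, by simp [vadd_eq_add]⟩

/-- **Submodularity of the number of runs**: `c_d(S ∪ T) + c_d(S ∩ T) ≤ c_d(S) + c_d(T)`, where
`c_d(X) = |(d + X) ∖ X|` counts the `d`-runs of `X` (a directed cut function).  The bookkeeping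
device for the component counts of [cite: HamidouneSerraZemor2006, §5, Lemma 22 (proof: «`A + B`
has 4 different `d`-components … we again get `|A+B| = 14`»)]. -/
theorem runs_union_add_runs_inter_le (d : ZMod p) (S T : Finset (ZMod p)) :
    #((d +ᵥ (S ∪ T)) \ (S ∪ T)) + #((d +ᵥ (S ∩ T)) \ (S ∩ T)) ≤
      #((d +ᵥ S) \ S) + #((d +ᵥ T) \ T) := by
  classical
  have h1 : (d +ᵥ (S ∪ T)) \ (S ∪ T) ∪ (d +ᵥ (S ∩ T)) \ (S ∩ T) ⊆
      (d +ᵥ S) \ S ∪ (d +ᵥ T) \ T := by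
    intro z
    simp only [mem_union, mem_sdiff, mem_inter, mem_vadd_iff']
    tauto
  have h2 : (d +ᵥ (S ∪ T)) \ (S ∪ T) ∩ ((d +ᵥ (S ∩ T)) \ (S ∩ T)) ⊆
      (d +ᵥ S) \ S ∩ ((d +ᵥ T) \ T) := by
    intro z
    simp only [mem_union, mem_sdiff, mem_inter, mem_vadd_iff']
    tauto
  have e1 := card_union_add_card_inter ((d +ᵥ (S ∪ T)) \ (S ∪ T)) ((d +ᵥ (S ∩ T)) \ (S ∩ T))
  have e2 := card_union_add_card_inter ((d +ᵥ S) \ S) ((d +ᵥ T) \ T)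
  have := card_le_card h1
  have := card_le_card h2
  omega

/-- Adding the translate `x + S` to `S` does not increase the number of `x`-runs.
[cite: HamidouneSerraZemor2006, §5, Lemma 22 (proof: «`B + {0,d}` must have at least three
`x`-components, since otherwise `A + B = B + {0,d} + {0,x}` cannot have 3 or more»)] -/
theorem runs_union_vadd_le (x : ZMod p) (S : Finset (ZMod p)) :
    #((x +ᵥ (S ∪ (x +ᵥ S))) \ (S ∪ (x +ᵥ S))) ≤ #((x +ᵥ S) \ S) := by
  classical
  calc #((x +ᵥ (S ∪ (x +ᵥ S))) \ (S ∪ (x +ᵥ S))) ≤ #(x +ᵥ ((x +ᵥ S) \ S)) := by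
        refine card_le_card fun z => ?_
        simp only [mem_sdiff, mem_union, mem_vadd_iff']
        tauto
    _ = #((x +ᵥ S) \ S) := card_vadd_finset _ _

/-- The number of runs is at most the number of elements. [cite: HamidouneSerraZemor2006, §2
(the number `c_r(X)` of `r`-components of `X`)] -/
theorem runs_le_card (d : ZMod p) (T : Finset (ZMod p)) : #((d +ᵥ T) \ T) ≤ #T :=
  (card_le_card sdiff_subset).trans (card_vadd_finset _ _).le

/-- `|S ∪ (x + S)| = |S| + c_x(S)`. [cite: HamidouneSerraZemor2006, §2 (`|X + {0,r}| = |X| + c_r(X)`)] -/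
theorem card_union_vadd (x : ZMod p) (S : Finset (ZMod p)) :
    #(S ∪ (x +ᵥ S)) = #S + #((x +ᵥ S) \ S) := by
  rw [← HamidouneRodseth.add_pair_zero_eq_union]
  exact Isoperimetric.card_add_pair_zero_eq S x

/-- **A run inside a two-run set lies inside one of the runs**: if `P`, `S₁`, `S₂` have at most one
`d`-run each (`S₁, S₂ ≠ ℤ/pℤ`), `P ⊆ S₁ ∪ S₂` and `S₁ ∪ S₂` has at least two runs, then `P ⊆ S₁`
or `P ⊆ S₂` — by submodularity, a run meeting both would glue them.
[cite: HamidouneSerraZemor2006, §5, Lemma 22 (proof: the sets `A_i + B_j` and the `d`-components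
of `A + B`)] -/
theorem subset_or_subset_of_two_le_runs {S₁ S₂ P : Finset (ZMod p)} {d : ZMod p} (hd : d ≠ 0)
    (h₁ : #((d +ᵥ S₁) \ S₁) ≤ 1) (h₂ : #((d +ᵥ S₂) \ S₂) ≤ 1) (hP : #((d +ᵥ P) \ P) ≤ 1)
    (hS₁u : S₁ ≠ univ) (hS₂u : S₂ ≠ univ) (hsub : P ⊆ S₁ ∪ S₂)
    (h2 : 2 ≤ #((d +ᵥ (S₁ ∪ S₂)) \ (S₁ ∪ S₂))) : P ⊆ S₁ ∨ P ⊆ S₂ := by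
  classical
  by_cases hm₁ : (S₁ ∩ P).Nonempty
  · by_cases hm₂ : (S₂ ∩ P).Nonempty
    · exfalso
      have k1 := runs_union_add_runs_inter_le d S₁ P
      have l1 : 1 ≤ #((d +ᵥ (S₁ ∩ P)) \ (S₁ ∩ P)) :=
        Isoperimetric.one_le_card_vadd_sdiff hm₁
          (fun h => hS₁u (univ_subset_iff.1 (by rw [← h]; exact inter_subset_left))) hd
      have k2 := runs_union_add_runs_inter_le d (S₁ ∪ P) S₂
      have hm : ((S₁ ∪ P) ∩ S₂).Nonempty := by
        obtain ⟨z, hz⟩ := hm₂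
        rw [mem_inter] at hz
        exact ⟨z, mem_inter.2 ⟨mem_union_right _ hz.2, hz.1⟩⟩
      have l2 : 1 ≤ #((d +ᵥ ((S₁ ∪ P) ∩ S₂)) \ ((S₁ ∪ P) ∩ S₂)) :=
        Isoperimetric.one_le_card_vadd_sdiff hm
          (fun h => hS₂u (univ_subset_iff.1 (by rw [← h]; exact inter_subset_right))) hd
      have he : S₁ ∪ P ∪ S₂ = S₁ ∪ S₂ := by rw [union_right_comm, union_eq_left.2 hsub]
      rw [he] at k2
      omega
    · left
      intro z hz
      rcases mem_union.1 (hsub hz) with h | h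
      · exact h
      · exact absurd ⟨z, mem_inter.2 ⟨h, hz⟩⟩ hm₂
  · right
    intro z hz
    rcases mem_union.1 (hsub hz) with h | h
    · exact absurd ⟨z, mem_inter.2 ⟨h, hz⟩⟩ hm₁
    · exact h

/-- `{c, c + d}` as a progression. [folklore] -/
private theorem apFinset_two (c d : ZMod p) : apFinset c d 2 = {c, c + d} := by
  ext z
  simp only [mem_apFinset, mem_insert, mem_singleton]
  constructor
  · rintro ⟨i, hi, rfl⟩
    interval_cases i
    · left; rw [zero_nsmul, add_zero]
    · right; rw [one_nsmul]
  · rintro (rfl | rfl)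
    · exact ⟨0, by omega, by rw [zero_nsmul, add_zero]⟩
    · exact ⟨1, by omega, by rw [one_nsmul]⟩

/-- `{y} + B = y + B`. [folklore] -/
private theorem singleton_add_eq_vadd (y : ZMod p) (B : Finset (ZMod p)) :
    ({y} : Finset (ZMod p)) + B = y +ᵥ B := by
  ext z
  simp [mem_add, mem_vadd_finset, vadd_eq_add]

end RunCalculus

section LemmaTwentyTwoCaseTwo

variable {p : ℕ} [hp : Fact p.Prime]

/-- **Lemma 22, second case, `|A₁| = 3`.**  With `A = {0, d, 2d} ∪ {y}` (`y` off the run),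
`|B| = 5`, `|A + B| = 10` and `A + B` with at least three `d`-runs: impossible.  If `B` has at
least three `d`-runs («`|A₁ + B| ≥ |B| + 3 + t` … `|A+B| ≥ |B| + 3 + t + (3 − t)`») the sum is too
big; if one, `A + B` is two runs; if two, the run `(A₁ + B) ∩ (y + B)` sits inside `y + B₁` with
`|B₁| = 4` and inside `A₁ + B₁`, forcing `y ∈ A₁`.
[cite: HamidouneSerraZemor2006, §5, Lemma 22 (proof, «let us first show that `|A₁| = 2`»)] -/
theorem false_of_three_one {A B : Finset (ZMod p)} {d y : ZMod p} (hd : d ≠ 0)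
    (hA : A = apFinset 0 d 3 ∪ {y}) (hy : y ∉ apFinset (0 : ZMod p) d 3) (hB : #B = 5)
    (hAB : #(A + B) = 10) (hp11 : 11 ≤ p) (H3 : 3 ≤ #((d +ᵥ (A + B)) \ (A + B))) : False := by
  classical
  have hBne : B.Nonempty := card_pos.1 (by omega)
  have hBu : B ≠ univ := fun h => by
    rw [h, card_univ, ZMod.card] at hB
    omega
  have hcB : 1 ≤ #((d +ᵥ B) \ B) := Isoperimetric.one_le_card_vadd_sdiff hBne hBu hd
  -- `{0, d, 2d} = {0,d} + {0,d}`
  have hE : apFinset (0 : ZMod p) d 2 = ({0, d} : Finset (ZMod p)) := by rw [apFinset_two, zero_add]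
  have hEEu : apFinset (0 : ZMod p) d 2 + apFinset 0 d 2 ≠ univ := fun h => by
    have h1 := card_add_le (s := apFinset (0 : ZMod p) d 2) (t := apFinset 0 d 2)
    rw [h, card_univ, ZMod.card, card_apFinset hd (by omega)] at h1
    omega
  have hA₁ : apFinset (0 : ZMod p) d 3 = ({0, d} : Finset (ZMod p)) + {0, d} := by
    have h1 := (HamidouneRodseth.apFinset_add_apFinset_eq hd (m := 2) (n := 2) (a := 0) (b := 0)
      (by omega) (by omega) hEEu).1
    rw [add_zero] at h1
    rw [← hE, h1]
  -- `S = A₁ + B = B'' `, `T = y + B`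
  obtain ⟨B', hB'⟩ : ∃ B' : Finset (ZMod p), B' = B ∪ (d +ᵥ B) := ⟨_, rfl⟩
  obtain ⟨S, hS⟩ : ∃ S : Finset (ZMod p), S = B' ∪ (d +ᵥ B') := ⟨_, rfl⟩
  obtain ⟨T, hT⟩ : ∃ T : Finset (ZMod p), T = y +ᵥ B := ⟨_, rfl⟩
  have hSeq : apFinset (0 : ZMod p) d 3 + B = S := by
    rw [hA₁, add_comm, ← add_assoc, HamidouneRodseth.add_pair_zero_eq_union B d, ← hB',
      HamidouneRodseth.add_pair_zero_eq_union B' d, ← hS]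
  have hU : A + B = S ∪ T := by rw [hA, union_add, hSeq, singleton_add_eq_vadd, ← hT]
  rw [hU] at hAB H3
  have hcardB' : #B' = 5 + #((d +ᵥ B) \ B) := by rw [hB', card_union_vadd, hB]
  have hcardS : #S = #B' + #((d +ᵥ B') \ B') := by rw [hS, card_union_vadd]
  have hcS : #((d +ᵥ S) \ S) ≤ #((d +ᵥ B') \ B') := by rw [hS]; exact runs_union_vadd_le d B'
  have hcB' : #((d +ᵥ B') \ B') ≤ #((d +ᵥ B) \ B) := by rw [hB']; exact runs_union_vadd_le d B
  have hcardT : #T = 5 := by rw [hT, card_vadd_finset, hB]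
  have hcT : #((d +ᵥ T) \ T) = #((d +ᵥ B) \ B) := by rw [hT, HamidouneRodseth.card_vadd_sdiff_vadd]
  -- `|S ∪ T| = |S| + |T ∖ S|` and `c(S ∪ T) ≤ c(S) + |T ∖ S|`
  have hcardU : #(T \ S) + #S = 10 := by rw [card_sdiff_add_card, union_comm, hAB]
  have hcU : #((d +ᵥ (S ∪ T)) \ (S ∪ T)) ≤ #((d +ᵥ S) \ S) + #(T \ S) := by
    have h1 := HamidouneRodseth.card_vadd_sdiff_union_le d S (T \ S)
    rw [union_sdiff_self_eq_union] at h1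
    exact h1.trans (by have := runs_le_card d (T \ S); omega)
  -- hence `B` has at most two runs
  have hcB2 : #((d +ᵥ B) \ B) ≤ 2 := by omega
  rcases Nat.lt_or_ge #((d +ᵥ B) \ B) 2 with hc1 | hc2
  · -- one run: `A + B` is two runs
    have h1 := HamidouneRodseth.card_vadd_sdiff_union_le d S T
    omega
  · have hc2 : #((d +ᵥ B) \ B) = 2 := by omega
    obtain ⟨b₁, b₂, m₁, m₂, hm₁, hm₂, hm, hBeq, -, hK₁, -, -, hK₂, -, -⟩ :=
      HamidouneRodseth.exists_two_components hd hc2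
    rw [hB] at hm
    -- the pieces of `T` and `S`
    have hTeq : T = apFinset (y + b₁) d m₁ ∪ apFinset (y + b₂) d m₂ := by
      rw [hT, hBeq, vadd_finset_union, vadd_apFinset, vadd_apFinset]
    have hSU : S ⊆ S ∪ T := subset_union_left
    have hSu : S ≠ univ := fun h => by
      have := card_le_card hSU
      rw [hAB] at this
      rw [h, card_univ, ZMod.card] at this
      omega
    have hRj : ∀ {b : ZMod p} {m : ℕ}, 1 ≤ m → apFinset b d m ⊆ B →
        apFinset 0 d 3 + apFinset b d m = apFinset b d (m + 2) := by
      intro b m hm1 hKB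
      have hne : apFinset (0 : ZMod p) d 3 + apFinset b d m ≠ univ := fun h => hSu (by
        apply univ_subset_iff.1
        rw [← h, ← hSeq]
        exact add_subset_add_left hKB)
      have h1 := (HamidouneRodseth.apFinset_add_apFinset_eq hd (by omega) hm1 hne).1
      rw [zero_add, show 3 + m - 1 = m + 2 by omega] at h1
      exact h1
    have hSeq2 : S = apFinset b₁ d (m₁ + 2) ∪ apFinset b₂ d (m₂ + 2) := by
      rw [← hSeq, hBeq, add_union, hRj hm₁ (hBeq ▸ hK₁), hRj hm₂ (hBeq ▸ hK₂)]
    -- Cauchy–Davenport: `|S| ≥ 7`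
    have hS7 : 7 ≤ #S := by
      have h1 := ZMod.cauchy_davenport hp.out (apFinset_nonempty (0 : ZMod p) d (n := 3) (by omega))
        hBne
      rw [card_apFinset hd (by omega), hB, hSeq] at h1
      have : min p (3 + 5 - 1) = 7 := by rw [min_eq_right (by omega)]
      omega
    -- the intersection `P`
    have hPcard := card_union_add_card_inter S T
    rw [hAB, hcardT] at hPcard
    have hPne : (S ∩ T).Nonempty := card_pos.1 (by omega)
    have hPu : S ∩ T ≠ univ := fun h => hSu (univ_subset_iff.1 (by rw [← h]; exact inter_subset_left))
    have hcP1 : 1 ≤ #((d +ᵥ (S ∩ T)) \ (S ∩ T)) := Isoperimetric.one_le_card_vadd_sdiff hPne hPu hd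
    have hsub := runs_union_add_runs_inter_le d S T
    have hcS2 : #((d +ᵥ S) \ S) ≤ 2 := by
      rw [hSeq2]
      refine (HamidouneRodseth.card_vadd_sdiff_union_le d _ _).trans ?_
      have := Isoperimetric.card_vadd_sdiff_apFinset_le_one b₁ d (m₁ + 2)
      have := Isoperimetric.card_vadd_sdiff_apFinset_le_one b₂ d (m₂ + 2)
      omega
    have hcSeq : #((d +ᵥ S) \ S) = 2 := by omega
    have hcP : #((d +ᵥ (S ∩ T)) \ (S ∩ T)) ≤ 1 := by omega
    -- the two runs of `S` are disjoint, so `|S| = 9` and `|P| = 4`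
    have hRdisj : Disjoint (apFinset b₁ d (m₁ + 2)) (apFinset b₂ d (m₂ + 2)) := by
      rw [disjoint_iff_inter_eq_empty]
      by_contra hne
      have hne' : (apFinset b₁ d (m₁ + 2) ∩ apFinset b₂ d (m₂ + 2)).Nonempty :=
        nonempty_iff_ne_empty.2 hne
      have k := runs_union_add_runs_inter_le d (apFinset b₁ d (m₁ + 2)) (apFinset b₂ d (m₂ + 2))
      rw [← hSeq2, hcSeq] at k
      have hR₁u : apFinset b₁ d (m₁ + 2) ≠ univ := fun h => by
        have := card_apFinset_le b₁ d (m₁ + 2)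
        rw [h, card_univ, ZMod.card] at this
        omega
      have l := Isoperimetric.one_le_card_vadd_sdiff hne'
        (fun h => hR₁u (univ_subset_iff.1 (by rw [← h]; exact inter_subset_left))) hd
      have := Isoperimetric.card_vadd_sdiff_apFinset_le_one b₁ d (m₁ + 2)
      have := Isoperimetric.card_vadd_sdiff_apFinset_le_one b₂ d (m₂ + 2)
      omega
    have hS9 : #S = 9 := by
      rw [hSeq2, card_union_of_disjoint hRdisj, card_apFinset hd (by omega),
        card_apFinset hd (by omega)]
      omega
    have hP4 : #(S ∩ T) = 4 := by omega
    obtain ⟨q, hPeq, -⟩ := Isoperimetric.exists_eq_apFinset_of_card_vadd_sdiff_le_one hd hPu hcP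
    rw [hP4] at hPeq
    -- `P` inside one piece of `T`, then inside the matching piece of `S`
    have hfin : ∀ {b b' : ZMod p} {m m' : ℕ}, m + m' = 5 → 1 ≤ m' →
        S = apFinset b d (m + 2) ∪ apFinset b' d (m' + 2) →
        S ∩ T ⊆ apFinset (y + b) d m → False := by
      intro b b' m m' hmm' hm' hSeq' hPT
      have hm4 : 4 ≤ m := by
        have := card_le_card hPT
        rw [hP4] at this
        exact this.trans (card_apFinset_le _ _ _)
      have hm4' : m = 4 := by omega
      subst hm4'
      have hRu : ∀ (b : ZMod p) (n : ℕ), n ≤ 6 → apFinset b d n ≠ univ := fun b n hn h => by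
        have := card_apFinset_le b d n
        rw [h, card_univ, ZMod.card] at this
        omega
      rcases subset_or_subset_of_two_le_runs hd (Isoperimetric.card_vadd_sdiff_apFinset_le_one _ _ _)
          (Isoperimetric.card_vadd_sdiff_apFinset_le_one _ _ _) hcP (hRu b (4 + 2) (by omega))
          (hRu b' (m' + 2) (by omega)) (by rw [← hSeq']; exact inter_subset_left)
          (by rw [← hSeq']; omega) with hPR | hPR'
      · rw [hPeq] at hPR hPT
        obtain ⟨i, hi, hi6⟩ := HamidouneRodseth.exists_offset_of_apFinset_subset hd (by omega)
          (by omega) hPR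
        obtain ⟨i', hi', hi4⟩ := HamidouneRodseth.exists_offset_of_apFinset_subset hd (by omega)
          (by omega) hPT
        have hi'0 : i' = 0 := by omega
        rw [hi'0, zero_nsmul, add_zero] at hi'
        apply hy
        refine mem_apFinset.2 ⟨i, by omega, ?_⟩
        rw [zero_add]
        -- `y + b = b + i • d`
        exact (add_right_cancel ((hi'.symm.trans hi).trans (add_comm b (i • d)))).symm
      · have := card_le_card hPR'
        rw [hPeq, card_apFinset hd (by omega)] at this
        exact absurd (this.trans (card_apFinset_le _ _ _)) (by omega)
    have hTu : ∀ (b : ZMod p) (n : ℕ), n ≤ 5 → apFinset b d n ≠ univ := fun b n hn h => by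
      have := card_apFinset_le b d n
      rw [h, card_univ, ZMod.card] at this
      omega
    have hcT2 : 2 ≤ #((d +ᵥ (apFinset (y + b₁) d m₁ ∪ apFinset (y + b₂) d m₂)) \
        (apFinset (y + b₁) d m₁ ∪ apFinset (y + b₂) d m₂)) := by rw [← hTeq]; omega
    rcases subset_or_subset_of_two_le_runs hd (Isoperimetric.card_vadd_sdiff_apFinset_le_one _ _ _)
        (Isoperimetric.card_vadd_sdiff_apFinset_le_one _ _ _) hcP (hTu _ m₁ (by omega))
        (hTu _ m₂ (by omega)) (by rw [← hTeq]; exact inter_subset_right) hcT2 with h | h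
    · exact hfin hm hm₂ hSeq2 h
    · exact hfin (by omega) hm₁ (by rw [hSeq2, union_comm]) h

end LemmaTwentyTwoCaseTwo

section LemmaTwentyTwoCaseTwoB

variable {p : ℕ} [hp : Fact p.Prime]

/-- **Lemma 22, second case, `|A₁| = |A₂| = 2`.**  With `A = {0, d} ∪ {x, x + d} = {0,x} + {0,d}`
(`x ∉ {0, ±d}`), `|B| = 5`, `|A + B| = 10` and `A + B` with at least three `d`-runs and at least
three `x`-runs: impossible.  As printed, `|A + B| = |B + {0,d}| + c_x(B + {0,d})` and
`c_x(B + {0,d}) ≥ c_x(A + B) ≥ 3` give `c_d(B) ≤ 2`; one run makes `A + B` two `d`-runs; with two,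
the `4`-point run `(B + {0,d}) ∩ (x + B + {0,d})` lies in a piece `B_i + {0,d}` and in its
`x`-translate, forcing `x ∈ {0, ±d}`.
[cite: HamidouneSerraZemor2006, §5, Lemma 22 (proof, «`A = {0,d} + {0,x}`» to the end)] -/
theorem false_of_two_two {A B : Finset (ZMod p)} {d x : ZMod p} (hd : d ≠ 0)
    (hA : A = apFinset 0 d 2 ∪ apFinset x d 2) (hx0 : x ≠ 0) (hxd : x ≠ d) (hxnd : x ≠ -d)
    (hB : #B = 5) (hAB : #(A + B) = 10) (hp11 : 11 ≤ p)
    (H3d : 3 ≤ #((d +ᵥ (A + B)) \ (A + B))) (H3x : 3 ≤ #((x +ᵥ (A + B)) \ (A + B))) :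
    False := by
  classical
  have hBne : B.Nonempty := card_pos.1 (by omega)
  have hBu : B ≠ univ := fun h => by
    rw [h, card_univ, ZMod.card] at hB
    omega
  have hcB : 1 ≤ #((d +ᵥ B) \ B) := Isoperimetric.one_le_card_vadd_sdiff hBne hBu hd
  have hE : apFinset (0 : ZMod p) d 2 = ({0, d} : Finset (ZMod p)) := by rw [apFinset_two, zero_add]
  -- `A = {0,d} + {0,x}` and `A + B = B' ∪ (x + B')`, `B' = B ∪ (d + B)`
  obtain ⟨B', hB'⟩ : ∃ B' : Finset (ZMod p), B' = B ∪ (d +ᵥ B) := ⟨_, rfl⟩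
  have hAeq : A = apFinset 0 d 2 + {0, x} := by
    rw [HamidouneRodseth.add_pair_zero_eq_union, hA, vadd_apFinset, add_zero]
  have hU : A + B = B' ∪ (x +ᵥ B') := by
    rw [hAeq, add_right_comm, add_comm (apFinset 0 d 2) B, hE,
      HamidouneRodseth.add_pair_zero_eq_union B d, ← hB', HamidouneRodseth.add_pair_zero_eq_union]
  rw [hU] at hAB H3d H3x
  have hcardB' : #B' = 5 + #((d +ᵥ B) \ B) := by rw [hB', card_union_vadd, hB]
  have hcardU : #(B' ∪ (x +ᵥ B')) = #B' + #((x +ᵥ B') \ B') := card_union_vadd x B'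
  have hcxU : #((x +ᵥ (B' ∪ (x +ᵥ B'))) \ (B' ∪ (x +ᵥ B'))) ≤ #((x +ᵥ B') \ B') :=
    runs_union_vadd_le x B'
  have hcdB' : #((d +ᵥ B') \ B') ≤ #((d +ᵥ B) \ B) := by rw [hB']; exact runs_union_vadd_le d B
  have hcdT : #((d +ᵥ (x +ᵥ B')) \ (x +ᵥ B')) = #((d +ᵥ B') \ B') := HamidouneRodseth.card_vadd_sdiff_vadd x d B'
  have hcB2 : #((d +ᵥ B) \ B) ≤ 2 := by omega
  rcases Nat.lt_or_ge #((d +ᵥ B) \ B) 2 with hc1 | hc2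
  · -- one run: `A + B` is two `d`-runs
    have h1 := HamidouneRodseth.card_vadd_sdiff_union_le d B' (x +ᵥ B')
    omega
  · have hc2 : #((d +ᵥ B) \ B) = 2 := by omega
    have hB'7 : #B' = 7 := by omega
    have hB'u : B' ≠ univ := fun h => by
      rw [h, card_univ, ZMod.card] at hB'7
      omega
    -- the intersection `P`, a run of four points
    have hPcard := card_union_add_card_inter B' (x +ᵥ B')
    rw [hAB, card_vadd_finset, hB'7] at hPcard
    have hP4 : #(B' ∩ (x +ᵥ B')) = 4 := by omega
    have hPne : (B' ∩ (x +ᵥ B')).Nonempty := card_pos.1 (by omega)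
    have hPu : B' ∩ (x +ᵥ B') ≠ univ := fun h =>
      hB'u (univ_subset_iff.1 (by rw [← h]; exact inter_subset_left))
    have hcP1 : 1 ≤ #((d +ᵥ (B' ∩ (x +ᵥ B'))) \ (B' ∩ (x +ᵥ B'))) :=
      Isoperimetric.one_le_card_vadd_sdiff hPne hPu hd
    have hsub := runs_union_add_runs_inter_le d B' (x +ᵥ B')
    have hcB'eq : #((d +ᵥ B') \ B') = 2 := by omega
    have hcP : #((d +ᵥ (B' ∩ (x +ᵥ B'))) \ (B' ∩ (x +ᵥ B'))) ≤ 1 := by omega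
    obtain ⟨q, hPeq, -⟩ := Isoperimetric.exists_eq_apFinset_of_card_vadd_sdiff_le_one hd hPu hcP
    rw [hP4] at hPeq
    -- the pieces of `B'` and of `x + B'`
    obtain ⟨b₁, b₂, m₁, m₂, hm₁, hm₂, hm, hBeq, -, hK₁, -, -, hK₂, -, -⟩ :=
      HamidouneRodseth.exists_two_components hd hc2
    rw [hB] at hm
    have hLj : ∀ {b : ZMod p} {m : ℕ}, 1 ≤ m → apFinset b d m ⊆ B →
        apFinset b d m + apFinset 0 d 2 = apFinset b d (m + 1) := by
      intro b m hm1 hKB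
      have hne : apFinset b d m + apFinset 0 d 2 ≠ univ := fun h => hB'u (by
        apply univ_subset_iff.1
        rw [← h, hB', ← HamidouneRodseth.add_pair_zero_eq_union, ← hE]
        exact add_subset_add_right hKB)
      have h1 := (HamidouneRodseth.apFinset_add_apFinset_eq hd hm1 (by omega) hne).1
      rw [add_zero, show m + 2 - 1 = m + 1 by omega] at h1
      exact h1
    have hB'eq : B' = apFinset b₁ d (m₁ + 1) ∪ apFinset b₂ d (m₂ + 1) := by
      rw [hB', ← HamidouneRodseth.add_pair_zero_eq_union, ← hE, hBeq, union_add,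
        hLj hm₁ (hBeq ▸ hK₁), hLj hm₂ (hBeq ▸ hK₂)]
    have hTeq : x +ᵥ B' = apFinset (x + b₁) d (m₁ + 1) ∪ apFinset (x + b₂) d (m₂ + 1) := by
      rw [hB'eq, vadd_finset_union, vadd_apFinset, vadd_apFinset]
    have hRu : ∀ (b : ZMod p) (n : ℕ), n ≤ 6 → apFinset b d n ≠ univ := fun b n hn h => by
      have := card_apFinset_le b d n
      rw [h, card_univ, ZMod.card] at this
      omega
    -- `P` inside one piece of `B'` and inside one piece of `x + B'`
    have h2S : 2 ≤ #((d +ᵥ (apFinset b₁ d (m₁ + 1) ∪ apFinset b₂ d (m₂ + 1))) \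
        (apFinset b₁ d (m₁ + 1) ∪ apFinset b₂ d (m₂ + 1))) := by rw [← hB'eq]; omega
    have h2T : 2 ≤ #((d +ᵥ (apFinset (x + b₁) d (m₁ + 1) ∪ apFinset (x + b₂) d (m₂ + 1))) \
        (apFinset (x + b₁) d (m₁ + 1) ∪ apFinset (x + b₂) d (m₂ + 1))) := by
      rw [← hTeq, hcdT]; omega
    have hPS := subset_or_subset_of_two_le_runs hd
      (Isoperimetric.card_vadd_sdiff_apFinset_le_one _ _ _)
      (Isoperimetric.card_vadd_sdiff_apFinset_le_one _ _ _) hcP (hRu _ _ (by omega))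
      (hRu _ _ (by omega)) (by rw [← hB'eq]; exact inter_subset_left) h2S
    have hPT := subset_or_subset_of_two_le_runs hd
      (Isoperimetric.card_vadd_sdiff_apFinset_le_one _ _ _)
      (Isoperimetric.card_vadd_sdiff_apFinset_le_one _ _ _) hcP (hRu _ _ (by omega))
      (hRu _ _ (by omega)) (by rw [← hTeq]; exact inter_subset_right) h2T
    rw [hPeq] at hPS hPT
    -- same piece: `x ∈ {0, ±d}`; different pieces: too many points
    have hsame : ∀ {b : ZMod p} {m : ℕ}, m ≤ 4 → apFinset q d 4 ⊆ apFinset b d (m + 1) →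
        apFinset q d 4 ⊆ apFinset (x + b) d (m + 1) → False := by
      intro b m hm4 h1 h2
      obtain ⟨i, hi, hi5⟩ := HamidouneRodseth.exists_offset_of_apFinset_subset hd (by omega)
        (by omega) h1
      obtain ⟨i', hi', hi5'⟩ := HamidouneRodseth.exists_offset_of_apFinset_subset hd (by omega)
        (by omega) h2
      have hx : x = i • d - i' • d := by
        have := hi.symm.trans hi'
        linear_combination (-1 : ZMod p) * this
      have hi1 : i ≤ 1 := by omega
      have hi'1 : i' ≤ 1 := by omega
      interval_cases i <;> interval_cases i' <;> simp [hx] at hx0 hxd hxnd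
    have hcross : ∀ {b b' : ZMod p} {m m' : ℕ}, m + m' = 5 → apFinset q d 4 ⊆ apFinset b d (m + 1) →
        apFinset q d 4 ⊆ apFinset b' d (m' + 1) → False := by
      intro b b' m m' hmm' h1 h2
      have := (card_le_card h1).trans (card_apFinset_le _ _ _)
      have := (card_le_card h2).trans (card_apFinset_le _ _ _)
      rw [card_apFinset hd (by omega)] at *
      omega
    rcases hPS with h1 | h1 <;> rcases hPT with h2 | h2
    · exact hsame (by omega) h1 h2
    · exact hcross hm h1 h2
    · exact hcross (by omega : m₂ + m₁ = 5) h1 h2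
    · exact hsame (by omega) h1 h2

/-- **Lemma 22, second case.**  `|A| = 4` with exactly two `d`-runs, `|B| = 5`, `|A + B| = 10`:
`A + B` has at most two runs in SOME direction (the printed «Assume now that `A + B` has at least
three `x`-components for every `x`» leads to a contradiction).  Reduction to `false_of_three_one` /
`false_of_two_two` by a translation putting a component of `A` at `0`.
[cite: HamidouneSerraZemor2006, §5, Lemma 22 (proof, second case)] -/
theorem false_of_two_runs {A B : Finset (ZMod p)} {d : ZMod p} (hd : d ≠ 0) (hA4 : #A = 4)
    (h2 : #((d +ᵥ A) \ A) = 2) (hB : #B = 5) (hAB : #(A + B) = 10) (hp11 : 11 ≤ p)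
    (H3 : ∀ x : ZMod p, x ≠ 0 → 3 ≤ #((x +ᵥ (A + B)) \ (A + B))) : False := by
  classical
  obtain ⟨a₁, a₂, n₁, n₂, hn₁, hn₂, hn, hAeq, hdisj, -, -, -, -, -, -⟩ :=
    HamidouneRodseth.exists_two_components hd h2
  rw [hA4] at hn
  have key : ∀ (a a' : ZMod p) (n n' : ℕ), n + n' = 4 → (n = 3 ∨ n = 2) →
      A = apFinset a d n ∪ apFinset a' d n' → Disjoint (apFinset a d n) (apFinset a' d n') →
      False := by
    intro a a' n n' hnn' hn3 hAeq hdisj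
    have hA' : (-a) +ᵥ A = apFinset 0 d n ∪ apFinset (-a + a') d n' := by
      rw [hAeq, vadd_finset_union, vadd_apFinset, vadd_apFinset, neg_add_cancel]
    have hAB' : #(((-a) +ᵥ A) + B) = 10 := by rw [vadd_add_assoc, card_vadd_finset, hAB]
    have H3' : ∀ x : ZMod p, x ≠ 0 →
        3 ≤ #((x +ᵥ (((-a) +ᵥ A) + B)) \ (((-a) +ᵥ A) + B)) := by
      intro x hx
      rw [vadd_add_assoc, HamidouneRodseth.card_vadd_sdiff_vadd]
      exact H3 x hx
    have ha : a ∈ apFinset a d n := mem_apFinset.2 ⟨0, by omega, by rw [zero_nsmul, add_zero]⟩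
    have ha' : a' ∈ apFinset a' d n' := mem_apFinset.2 ⟨0, by omega, by rw [zero_nsmul, add_zero]⟩
    rcases hn3 with rfl | rfl
    · have hn'1 : n' = 1 := by omega
      subst hn'1
      rw [apFinset_one] at hA'
      refine false_of_three_one hd hA' (fun h => ?_) hB hAB' hp11 (H3' d hd)
      obtain ⟨i, hi, he⟩ := mem_apFinset.1 h
      rw [zero_add] at he
      have hmem : a' ∈ apFinset a d 3 := mem_apFinset.2 ⟨i, hi, by rw [he, add_neg_cancel_left]⟩
      exact disjoint_left.1 hdisj hmem (by rw [apFinset_one, mem_singleton])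
    · have hn'2 : n' = 2 := by omega
      subst hn'2
      refine false_of_two_two hd hA' (fun h => ?_) (fun h => ?_) (fun h => ?_) hB hAB' hp11
        (H3' d hd) (H3' (-a + a') ?_)
      · have : a' = a := by linear_combination h
        exact disjoint_left.1 hdisj ha (this ▸ ha')
      · have : a' = a + 1 • d := by rw [one_nsmul]; linear_combination h
        exact disjoint_left.1 hdisj (mem_apFinset.2 ⟨1, by omega, this.symm⟩) ha'
      · have : a = a' + 1 • d := by rw [one_nsmul]; linear_combination -h
        exact disjoint_left.1 hdisj ha (mem_apFinset.2 ⟨1, by omega, this.symm⟩)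
      · intro h
        have : a' = a := by linear_combination h
        exact disjoint_left.1 hdisj ha (this ▸ ha')
  rcases (by omega : n₁ = 1 ∨ n₁ = 2 ∨ n₁ = 3) with h | h | h
  · exact key a₂ a₁ n₂ n₁ (by omega) (by omega) (by rw [hAeq, union_comm]) hdisj.symm
  · exact key a₁ a₂ n₁ n₂ hn (by omega) hAeq hdisj
  · exact key a₁ a₂ n₁ n₂ hn (by omega) hAeq hdisj

/-- **Lemma 22** («Let `p > 23` and let `A, B ⊂ ℤ/pℤ` with `0 ∈ A ∩ B`, `|A| = 4`, `|B| = 5` and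
`|A + B| = 10`.  Then there exists `r` with `ℓ_r(A) ≤ 6` and `ℓ_r(B) ≤ 7`»), here for `p ≥ 37`
(see `lemma22_of_runs_le_two`) and `|A + B| ≤ 10`.  Proof: `|A + B| ≤ 9` is Vosper /
Hamidoune–Rødseth; otherwise, if `A + B` has at most two runs in some direction, the first case;
else Lemma 20 gives `d` with `c_d(A) ≤ 2`: one run and Theorem 10 (`compression_transfer`)
compresses `B` too, two runs are impossible (`false_of_two_runs`).
[cite: HamidouneSerraZemor2006, §5, Lemma 22] -/
theorem lemma22 (hp37 : 37 ≤ p) {A B : Finset (ZMod p)} (h0A : (0 : ZMod p) ∈ A)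
    (h0B : (0 : ZMod p) ∈ B) (hA : #A = 4) (hB : #B = 5) (hAB : #(A + B) ≤ 10) :
    ∃ r : ZMod p, r ≠ 0 ∧ (∃ a, A ⊆ apFinset a r 6) ∧ ∃ b, B ⊆ apFinset b r 7 := by
  classical
  by_cases h9 : #(A + B) ≤ 9
  · obtain ⟨r, hr, a, b, hAr, hBr⟩ := exists_common_apFinset_of_card_add_le (X := A) (Y := B)
      (by omega) (by omega) (by omega) (by omega) (by omega)
    rw [hA] at hAr
    rw [hB] at hBr
    exact ⟨r, hr, ⟨a, hAr.trans (Rectification.apFinset_subset_apFinset_of_le a r (by norm_num))⟩,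
      ⟨b, hBr.trans (Rectification.apFinset_subset_apFinset_of_le b r (by norm_num))⟩⟩
  have h10 : #(A + B) = 10 := by omega
  by_cases hx : ∃ x : ZMod p, x ≠ 0 ∧ #((x +ᵥ (A + B)) \ (A + B)) ≤ 2
  · obtain ⟨x, hx, hruns⟩ := hx
    exact lemma22_of_runs_le_two h0A h0B hA hB hAB hx hruns hp37
  push Not at hx
  obtain ⟨d, hd, hdA⟩ := exists_card_vadd_sdiff_le_two h0A hA hB hAB (by omega)
  have hAu : A ≠ univ := fun h => by
    rw [h, card_univ, ZMod.card] at hA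
    omega
  rcases Nat.lt_or_ge #((d +ᵥ A) \ A) 2 with h1 | h2
  · -- `A` is a `d`-progression: Theorem 10 transfers the compression to `B`
    obtain ⟨a, hAeq, -⟩ := Isoperimetric.exists_eq_apFinset_of_card_vadd_sdiff_le_one hd hAu
      (by omega)
    rw [hA] at hAeq
    have hArun : A ⊆ apFinset a d (#A + 2) := by
      intro z hz
      rw [hAeq] at hz
      rw [hA]
      exact Rectification.apFinset_subset_apFinset_of_le a d (by norm_num) hz
    obtain ⟨b, hBb⟩ := CompressionTransfer.compression_transfer (X := B) (Y := A) (by omega) hd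
      (by omega) (by omega) (by rw [add_comm B A]; omega) (by rw [add_comm B A]; omega) hArun
    rw [hB] at hBb
    rw [hA] at hArun
    exact ⟨d, hd, ⟨a, hArun⟩, ⟨b, hBb⟩⟩
  · exact (false_of_two_runs hd hA (by omega) hB h10 (by omega) fun x hx0 => hx x hx0).elim

/-- **Theorem 3** (Hamidoune–Serra–Zémor 2006, the case `m = 1` of the critical pair conjecture in
`ℤ/pℤ`): «Let `A, B` be subsets of `ℤ/pℤ` such that `|A| ≥ 4` and `|B| ≥ 5`.  If `p ≥ 53` and
`|A + B| ≤ |A| + |B| + 1 ≤ p − 5`, then there is `r ∈ ℤ/pℤ` such that `ℓ_r(A) ≤ |A| + 2` and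
`ℓ_r(B) ≤ |B| + 2`» — `main_of_lemma22` fed with `lemma22`.
[cite: HamidouneSerraZemor2006, §1, Theorem 3; §6 (proof)] -/
theorem two_above_critical_pair (hp53 : 53 ≤ p) {A B : Finset (ZMod p)} (hA4 : 4 ≤ #A)
    (hB5 : 5 ≤ #B) (hAB : #(A + B) ≤ #A + #B + 1) (hABp : #A + #B + 6 ≤ p) :
    ∃ r : ZMod p, r ≠ 0 ∧ (∃ a, A ⊆ apFinset a r (#A + 2)) ∧ ∃ b, B ⊆ apFinset b r (#B + 2) :=
  main_of_lemma22 (fun _ _ h0X h0U hX hU hXU => lemma22 (by omega) h0X h0U hX hU hXU.le) hp53 hA4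
    hB5 hAB hABp

end LemmaTwentyTwoCaseTwoB

section Corollary

variable {p : ℕ} [hp : Fact p.Prime]

/-- **Theorem 3, symmetric form** (the statement is symmetric in `A` and `B` up to which side has
five elements): `|A|, |B| ≥ 4`, `max(|A|, |B|) ≥ 5`, `p ≥ 53`, `|A + B| ≤ |A| + |B| + 1 ≤ p − 5` ⇒ a
common `r ≠ 0` with `A` in an `r`-progression of `|A| + 2` terms and `B` in one of `|B| + 2` terms.
[cite: HamidouneSerraZemor2006, §1, Theorem 3] -/
theorem two_above_critical_pair_symm (hp53 : 53 ≤ p) {A B : Finset (ZMod p)} (hA4 : 4 ≤ #A)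
    (hB4 : 4 ≤ #B) (h5 : 5 ≤ max #A #B) (hAB : #(A + B) ≤ #A + #B + 1) (hABp : #A + #B + 6 ≤ p) :
    ∃ r : ZMod p, r ≠ 0 ∧ (∃ a, A ⊆ apFinset a r (#A + 2)) ∧ ∃ b, B ⊆ apFinset b r (#B + 2) := by
  rcases le_or_gt 5 #B with hB5 | hB5
  · exact two_above_critical_pair hp53 hA4 hB5 hAB hABp
  · have hA5 : 5 ≤ #A := by
      rcases le_max_iff.1 h5 with h | h
      · exact h
      · omega
    obtain ⟨r, hr, hB, hA⟩ := two_above_critical_pair hp53 hB4 hA5 (by rw [add_comm B A]; omega)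
      (by omega)
    exact ⟨r, hr, hA, hB⟩

end Corollary

end HSZMain

end Literature.Combinatorics.Additive
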